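import Summits.KontsevichZagierPeriods.Zeta5Search.RecurrenceCertificateDecay
import Summits.KontsevichZagierPeriods.Zeta5Search.CalibrationAperyRates
import Summits.KontsevichZagierPeriods.Zeta5Search.Certificates.RowCertificate
import Literature.NumberTheory.DiophantineApproximation.DilogLandenLinearIndependenceRates
import HarnessLib

/-!
# ζ(5) search — every FORMAT A′ certificate with Poincaré data is a `RowCertificate` (cell `pub-zeta5`, certifier `cert-1`)

HONEST FRAMING: systematic search; no irrationality claim unless certified.

Bridge from the typer's finitary order-2 format to the row format of `Certificates/RowCertificate.lean`:
a `RecurrenceCertificate ξ` (`R`) together with its Poincaré limit data `D : R.LimitData`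
(`RecurrenceCertificateRates.lean`: `sₙ → a`, `tₙ → b`, dominant root `λ∞`) and `0 < b` carries
EXACT rates — growth `log λ∞` (`D.tendsto_log_u_div`), decay `log λ∞ − log b` (Abel + same-sign
telescoping, `D.tendsto_log_abs_form_div`), denominators `δ₀ = Σ cᵢ kᵢ` (PNT,
`tendsto_log_prod_lcmUpto_pow_div` below) — hence

* `LimitData.toRowCertificate D hb : RowCertificate ξ`, with
  `margin = log λ∞ − log b − δ₀` (`toRowCertificate_margin`; positive: `D.gap_pos`) and
  `worthiness = 1 + (log λ∞ − log b − δ₀)/(log λ∞ + δ₀)` (`toRowCertificate_worthiness`).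

So a searched order-2 hit certified in FORMAT A′ gets its NEAR-MISSES row (exact `μ₁`, exact `γ`)
for free, and `RowCertificate.irrational` / `.not_liouvilleWith` apply. Calibration: Apéry's
`aperyLimitData` gives margin `log(17+12√2) − 3` and the same worthiness as
`Certificates.AperyRow.aperyRow` (`apery_toRow_margin`, `apery_toRow_worthiness`).
Also here: the PNT rate of the standard denominators as an exact LIMIT,
`tendsto_log_prod_lcmUpto_pow_div : log(∏ᵢ lcm(1..cᵢn)^{kᵢ})/n → Σᵢ cᵢkᵢ` (the tree had the
eventual upper bound `eventually_prod_lcmUpto_pow_le_exp`). No named facts.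
-/

noncomputable section

open Filter Topology Finset
open Literature.NumberTheory.Transcendental

namespace Summit.KontsevichZagierPeriods.Zeta5Search

/-! ### PNT: the exact rate of `∏ᵢ lcm(1..cᵢ n)^{kᵢ}` -/

/-- `log lcm(1..c n)/n → c` for every natural `c` (`c = 0`: `lcm(∅) = 1`). -/
theorem tendsto_log_lcmUpto_mul_div' (c : ℕ) :
    Tendsto (fun n : ℕ => Real.log (Nat.lcmUpto (c * n)) / n) atTop (𝓝 (c : ℝ)) := by
  rcases Nat.eq_zero_or_pos c with rfl | hc
  · have e : (fun n : ℕ => Real.log (Nat.lcmUpto (0 * n)) / n) = fun _ => 0 := by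
      funext n
      simp [Nat.lcmUpto]
    rw [e]; simp
  · exact Literature.NumberTheory.DiophantineApproximation.ViolaZudilin.tendsto_log_lcmUpto_mul_div hc

/-- **PNT rate of the standard denominators**: `log(∏ᵢ lcm(1..cᵢ n)^{kᵢ})/n → Σᵢ cᵢ kᵢ`. -/
theorem tendsto_log_prod_lcmUpto_pow_div {m : ℕ} (c k : Fin m → ℕ) :
    Tendsto (fun n : ℕ => Real.log ((∏ i, Nat.lcmUpto (c i * n) ^ k i : ℕ) : ℝ) / n) atTop
      (𝓝 (∑ i, ((c i * k i : ℕ) : ℝ))) := by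
  have h : Tendsto (fun n : ℕ => ∑ i, (k i : ℝ) * (Real.log (Nat.lcmUpto (c i * n)) / n)) atTop
      (𝓝 (∑ i, (k i : ℝ) * (c i : ℝ))) :=
    tendsto_finsetSum _ fun i _ => (tendsto_log_lcmUpto_mul_div' (c i)).const_mul _
  have e : (∑ i, (k i : ℝ) * (c i : ℝ)) = ∑ i, ((c i * k i : ℕ) : ℝ) := by
    push_cast; exact Finset.sum_congr rfl fun i _ => mul_comm _ _
  rw [e] at h
  refine h.congr fun n => ?_
  have hpos : ∀ i, (0 : ℝ) < Nat.lcmUpto (c i * n) := fun i => by exact_mod_cast Nat.lcmUpto_pos _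
  push_cast
  rw [Real.log_prod]
  · rw [Finset.sum_div]
    refine Finset.sum_congr rfl fun i _ => ?_
    rw [Real.log_pow]; ring
  · intro i _
    exact pow_ne_zero _ (hpos i).ne'

namespace RecurrenceCertificate

namespace LimitData

variable {ξ : ℝ} {R : RecurrenceCertificate ξ} (D : LimitData R)

/-- **FORMAT A′ + Poincaré data ⇒ row certificate.** `u, v` of `R`; `b = log λ∞`,
`c = log λ∞ − log b`, `Dₙ = ∏ᵢ lcm(1..cᵢ n)^{kᵢ}`, `δ = Σ cᵢ kᵢ` — all fields theorems of the tree. -/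
def toRowCertificate (hb : 0 < D.b) : Certificates.RowCertificate ξ where
  u := R.u
  v := R.v
  growthRate := Real.log D.lam
  decayRate := Real.log D.lam - Real.log D.b
  tendsto_growth := by
    refine D.tendsto_log_u_div.congr' ?_
    filter_upwards [eventually_ge_atTop R.N] with n hn
    rw [abs_of_pos (R.u_real_pos n hn)]
  tendsto_decay := by
    have h := D.tendsto_log_abs_form_div hb
    rw [show Real.log D.b - Real.log D.lam = -(Real.log D.lam - Real.log D.b) by ring] at h
    exact h
  decayRate_pos := by
    have h := D.gap_pos hb
    have h0 : 0 ≤ R.denomRate₀ := by unfold RecurrenceCertificate.denomRate₀; positivity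
    linarith
  denom n := ∏ i, Nat.lcmUpto (R.c i * n) ^ R.k i
  denom_pos n := prod_lcmUpto_pow_pos R.c R.k n
  denomRate := R.denomRate₀
  tendsto_denom := tendsto_log_prod_lcmUpto_pow_div R.c R.k
  isInt_u := by
    filter_upwards [eventually_ge_atTop R.N] with n hn
    exact R.isInt_u n hn
  isInt_v := by
    filter_upwards [eventually_ge_atTop R.N] with n hn
    exact R.isInt_v n hn

/-- The row's margin is the certificate's gap: `μ₁ = log λ∞ − log b − δ₀` (`> 0` by `gap_pos`). -/
theorem toRowCertificate_margin (hb : 0 < D.b) :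
    (D.toRowCertificate hb).margin = Real.log D.lam - Real.log D.b - R.denomRate₀ := rfl

/-- The margin is positive (every FORMAT A′ certificate is a hit). -/
theorem toRowCertificate_margin_pos (hb : 0 < D.b) : 0 < (D.toRowCertificate hb).margin :=
  D.gap_pos hb

/-- The row's coefficient rate: `Q = log λ∞ + δ₀`. -/
theorem toRowCertificate_coeffRate (hb : 0 < D.b) :
    (D.toRowCertificate hb).coeffRate = Real.log D.lam + R.denomRate₀ := rfl

/-- The row's worthiness: `γ = 1 + (log λ∞ − log b − δ₀)/(log λ∞ + δ₀)`. -/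
theorem toRowCertificate_worthiness (hb : 0 < D.b) :
    (D.toRowCertificate hb).worthiness =
      1 + (Real.log D.lam - Real.log D.b - R.denomRate₀) / (Real.log D.lam + R.denomRate₀) := rfl

/-- Irrationality through the row (the same conclusion as `R.irrational`, routed through C1 on rates). -/
theorem irrational_of_row (hb : 0 < D.b) : Irrational ξ :=
  (D.toRowCertificate hb).irrational (D.toRowCertificate_margin_pos hb)

end LimitData

end RecurrenceCertificate

/-! ### Calibration: Apéry through the bridge -/

namespace Certificates

open CalibrationAperyRecurrence

/-- Apéry's limit data has `b = 1 > 0`. -/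
theorem apery_b_pos : 0 < aperyLimitData.b := by norm_num [aperyLimitData]

/-- The Apéry row obtained through the bridge has margin `log(17+12√2) − 3`. -/
theorem apery_toRow_margin :
    (aperyLimitData.toRowCertificate apery_b_pos).margin = Real.log (17 + 12 * Real.sqrt 2) - 3 := by
  rw [RecurrenceCertificate.LimitData.toRowCertificate_margin, denomRate₀_apery]
  simp [aperyLimitData]

/-- … and worthiness `1 + (log(17+12√2) − 3)/(log(17+12√2) + 3)` (= `AperyRow.aperyRow.worthiness`). -/
theorem apery_toRow_worthiness :
    (aperyLimitData.toRowCertificate apery_b_pos).worthiness =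
      1 + (Real.log (17 + 12 * Real.sqrt 2) - 3) / (Real.log (17 + 12 * Real.sqrt 2) + 3) := by
  rw [RecurrenceCertificate.LimitData.toRowCertificate_worthiness, denomRate₀_apery]
  simp [aperyLimitData]

end Certificates

end Summit.KontsevichZagierPeriods.Zeta5Search
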